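import Summits.CriticalPhenomena.PercolationContinuityZ3.Theorems.Transplant.BccSlabSqShadow
import Summits.CriticalPhenomena.PercolationContinuityZ3.Theorems.Transplant.SqShadowVRoutingX
import Summits.CriticalPhenomena.PercolationContinuityZ3.Theorems.Transplant.SqShadowInjective
import Summits.CriticalPhenomena.PercolationContinuityZ3.Theorems.Transplant.DiamondFilmSqShadowX
import HarnessLib

/-!
# The bcc (001)-slabs at their own critical point WITHOUT p205010: `θ_{S_k(bcc)}(v, p_c(S_k(bcc))) = 0` MODULO the routing
# certificate `ShapedLinkageX R` of the square shadow alone (every `k ≥ 1`, any `R ≥ 1`) — and UNCONDITIONALLY for the bilayer `k = 1`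

builds on p205010 (kernel theorem, internal audit signed; external expert review pending) — NOT used in this file (the row by name,
«BccSlabCritical».`BccSlab.bccSlab_criticalContinuity`, goes through p205010; the theorems below go through the square DST layer «SqShadow*» only).
Lane `prim-bschramm`, seat `prim-bschramm-p2` (gen 45; class C1b, METHOD = input substitution; memo `HOME/bschramm/P2-LATTICES.md` §155); helper file
(`--supports stmt-CriticalPhenomena-4575 --as helper`).

With the square shadow `BccSlab.sqShadow k` («BccSlabSqShadow»: `sh = bccSkel`, every bcc bond an axis step of `ℤ²`), Duminil-Copin–Sidoravicius–Tassion's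
slab argument as typed in the tree for square shadows (eq. (1), Lemmata 4–7, eqs. (10)–(13), §2.2, Facts 1–2 with the exit property of the witness —
«SqShadowVRoutingX».`SqShadow.theta_criticalProb_eq_zero_of_shapedLinkageX`) applies to `S_k(bcc)` once the instance supplies: connectedness, a.s.
uniqueness of the infinite cluster (Burton–Keane, «BccSlabSqShadow»), inhabited columns (`sh_surjective`), and CONNECTED SQUARE LIFTS — proved here:
* §1 bonds to a prescribed shadow step and height step (`exists_adj_step`: all eight combinations `(±eᵢ, ±1)` are bonds);
* §2 `JoinedIn S` (walks over a column set) and the descent of every vertex over a square of radius `≥ 1` to height `≤ 1` inside the square;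
* §3 the LOW LAYER `{height ≤ 1}` over `ℤ²` is a copy of the square lattice (one vertex `lowV z` per column, `lowV z ∼ lowV (z ± eᵢ)`), so low
  vertices over a square are joined inside it by lattice paths (`joined_lowV`);
* §4 **`exists_walk_in_lift_sqBall`** (`k ≥ 1`), **`connected`** (`k ≥ 1`);
* §5 **`theta_criticalProb_eq_zero_of_shapedLinkageX`** (`k ≥ 1`, `R ≥ 1`), `…_of_localLinkage`, `…_of_shapedLinkage`, and
  **`theta_criticalProb_eq_zero_of_le_one`**: for `k ≤ 1` the shadow is injective, DST's exceptional event is empty and `θ(p_c) = 0` holds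
  UNCONDITIONALLY (the bilayer `S_1(bcc)` is the square lattice drawn diagonally — Harris' theorem as a consistency instance of the transplant).
What remains for `k ≥ 2` is the finite routing certificate `(BccSlab.sqShadow k).ShapedLinkageX R` (the analogue of the «DkSK*» certificates of the even
diamond films), per `k` or by a uniform template: every vertex of `S_k(bcc)` has four neighbours in each adjacent layer, so the instance is FAT, not thin.
[cite: DuminilCopinSidoraviciusTassion2016, Thm. 1 and §2; p. 2 "Two generalizations"] [cite: ConwaySloane1999, Ch. 4 §7.1] [cite: BenjaminiSchramm1996, Conj. 4 / Question 3]
[cite: Harris1960, Thm.]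
-/

noncomputable section

namespace Summit.CriticalPhenomena.PercolationContinuityZ3.Theorems.Transplant

namespace BccSlab

open MeasureTheory Literature.Probability.Percolation Literature.Probability.LatticeModels SimpleGraph Filter
open BccConc (add_mem_bccSite bccGraph_adj_addUnit)
open DiamondFilm (exists_sign_step_mem mem_sqBall_between add_single_apply)
open scoped Classical

variable {k : ℕ}

/-! ## §1 Bonds to a prescribed shadow step and height step -/

/-- `σ • eᵢ = Pi.single i σ` in `ℤ²`. [folklore] -/
theorem smul_single_one (i : Fin 2) (σ : ℤ) : σ • (Pi.single i 1 : Site 2) = Pi.single i σ := by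
  ext j
  by_cases hj : j = i
  · subst hj; rw [Pi.smul_apply, Pi.single_eq_same, Pi.single_eq_same, smul_eq_mul, mul_one]
  · rw [Pi.smul_apply, Pi.single_eq_of_ne hj, Pi.single_eq_of_ne hj, smul_zero]

/-- **All eight combinations `(±eᵢ, ±1)` are bonds of the slab**: from `x`, for a shadow direction `i`, a sign `σ` and a height step `τ = ±1` keeping the
height in `[0, k]`, the vertex `x + (σ, ±σ, τ)` is a slab neighbour of `x` over `sh x + σ eᵢ` at height `x₂ + τ`. [cite: ConwaySloane1999, Ch. 4 §7.1] -/
theorem exists_adj_step (x : bslab k) (i : Fin 2) {σ τ : ℤ} (hσ : σ = 1 ∨ σ = -1) (hτ : τ = 1 ∨ τ = -1)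
    (h0 : 0 ≤ ((x : bccSite) : Site 3) 2 + τ) (hk : ((x : bccSite) : Site 3) 2 + τ ≤ k) :
    ∃ y : bslab k, (slabGraph k).Adj x y ∧ ((y : bccSite) : Site 3) 2 = ((x : bccSite) : Site 3) 2 + τ ∧ sh y = sh x + σ • Pi.single i 1 := by
  set y' : bccSite := ⟨((x : bccSite) : Site 3) + stepVec3 i σ τ, add_mem_bccSite (x : bccSite).2 (stepVec3_unit i hσ hτ)⟩ with hy'
  have hy2 : (y' : Site 3) 2 = ((x : bccSite) : Site 3) 2 + τ := by
    simp only [hy', Pi.add_apply, stepVec3, Matrix.cons_val_two, Matrix.tail_cons, Matrix.head_cons]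
  refine ⟨⟨y', by rw [mem_bslab, hy2]; exact ⟨h0, hk⟩⟩, ?_, hy2, ?_⟩
  · exact bccGraph_adj_addUnit (x : bccSite) (stepVec3_unit i hσ hτ)
  · rw [sh_eq, sh_eq, smul_single_one]
    exact bccSkel_add_stepVec3 (x : bccSite) i hσ hτ

/-! ## §2 Walks over a column set; descent to the low layer -/

/-- Joined inside the lift of a column set `S`: a walk of the slab all of whose vertices lie over `S`. [folklore] -/
def JoinedIn (S : Set (Site 2)) (a b : bslab k) : Prop :=
  ∃ p : (slabGraph k).Walk a b, ∀ v ∈ p.support, sh v ∈ S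

/-- `JoinedIn S` is reflexive on vertices over `S`. [folklore] -/
theorem JoinedIn.refl {S : Set (Site 2)} {a : bslab k} (ha : sh a ∈ S) : JoinedIn S a a :=
  ⟨Walk.nil, fun v hv => by rw [Walk.support_nil, List.mem_singleton] at hv; rw [hv]; exact ha⟩

/-- `JoinedIn S` is symmetric. [folklore] -/
theorem JoinedIn.symm {S : Set (Site 2)} {a b : bslab k} (h : JoinedIn S a b) : JoinedIn S b a := by
  obtain ⟨p, hp⟩ := h
  exact ⟨p.reverse, fun v hv => hp v (by rw [Walk.support_reverse, List.mem_reverse] at hv; exact hv)⟩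

/-- `JoinedIn S` is transitive. [folklore] -/
theorem JoinedIn.trans {S : Set (Site 2)} {a b c : bslab k} (h₁ : JoinedIn S a b) (h₂ : JoinedIn S b c) : JoinedIn S a c := by
  obtain ⟨p, hp⟩ := h₁
  obtain ⟨q, hq⟩ := h₂
  refine ⟨p.append q, fun v hv => ?_⟩
  rw [Walk.support_append, List.mem_append] at hv
  rcases hv with hv | hv
  · exact hp v hv
  · exact hq v (List.tail_subset _ hv)

/-- One edge between vertices over `S`. [folklore] -/
theorem JoinedIn.of_adj {S : Set (Site 2)} {a b : bslab k} (h : (slabGraph k).Adj a b) (ha : sh a ∈ S) (hb : sh b ∈ S) : JoinedIn S a b :=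
  ⟨Walk.cons h Walk.nil, fun v hv => by
    rw [Walk.support_cons, Walk.support_nil, List.mem_cons, List.mem_singleton] at hv
    rcases hv with hv | hv <;> rw [hv] <;> assumption⟩

/-- A `JoinedIn` pair yields a walk inside the lift (the form «SqShadowVRoutingX» consumes). [folklore] -/
theorem JoinedIn.exists_walk {S : Set (Site 2)} {a b : bslab k} (h : JoinedIn S a b) :
    ∃ p : (slabGraph k).Walk a b, ∀ v ∈ p.support, v ∈ (sqShadow k).lift S := by
  obtain ⟨p, hp⟩ := h
  exact ⟨p, fun v hv => by rw [SqShadow.mem_lift, sqShadow_sh]; exact hp v hv⟩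

/-- **Every vertex over a square of radius `≥ 1` is joined, inside the square, to a vertex of height `≤ 1`**: step down one layer at a time, each time
along `±e₀` with the sign chosen to stay inside the square. [cite: ConwaySloane1999, Ch. 4 §7.1] -/
theorem exists_joined_low {c : Site 2} {u : ℕ} (hu : 1 ≤ u) :
    ∀ (n : ℕ) (x : bslab k), ((x : bccSite) : Site 3) 2 ≤ n → sh x ∈ sqBall c u →
      ∃ y : bslab k, ((y : bccSite) : Site 3) 2 ≤ 1 ∧ sh y ∈ sqBall c u ∧ JoinedIn (sqBall c u) x y := by
  intro n
  induction n with
  | zero =>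
    intro x hx0 hxS
    exact ⟨x, by omega, hxS, JoinedIn.refl hxS⟩
  | succ n ih =>
    intro x hxn hxS
    by_cases hle : ((x : bccSite) : Site 3) 2 ≤ n
    · exact ih x hle hxS
    · by_cases h1 : ((x : bccSite) : Site 3) 2 ≤ 1
      · exact ⟨x, h1, hxS, JoinedIn.refl hxS⟩
      · obtain ⟨-, hxk⟩ := mem_bslab.1 x.2
        obtain ⟨σ, hσ, hmem⟩ := exists_sign_step_mem hu hxS 0
        obtain ⟨y, hy, hy2, hysh⟩ := exists_adj_step x 0 hσ (Or.inr rfl) (by omega) (by omega)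
        have hyS : sh y ∈ sqBall c u := by rw [hysh]; exact hmem
        obtain ⟨w, hw1, hwS, hJ⟩ := ih y (by omega) hyS
        exact ⟨w, hw1, hwS, (JoinedIn.of_adj hy hxS hyS).trans hJ⟩

/-! ## §3 The low layer is a copy of the square lattice -/

/-- The height in `{0, 1}` of the low vertex over `z`: the parity of `z₀ + z₁`. [folklore] -/
def lowHeight (z : Site 2) : ℤ := (z 0 + z 1) % 2

/-- `0 ≤ lowHeight z ≤ 1` and `z₀ + z₁ − lowHeight z` is even. [folklore] -/
theorem lowHeight_facts (z : Site 2) : 0 ≤ lowHeight z ∧ lowHeight z ≤ 1 ∧ Even (z 0 + z 1 - lowHeight z) := by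
  refine ⟨Int.emod_nonneg _ two_ne_zero, ?_, ⟨(z 0 + z 1) / 2, ?_⟩⟩
  · have := Int.emod_lt_of_pos (z 0 + z 1) two_pos; unfold lowHeight; omega
  · unfold lowHeight; omega

/-- **The low vertex over `z`** (`k ≥ 1`): height `0` or `1` according to the parity of `z₀ + z₁`. [cite: ConwaySloane1999, Ch. 4 §7.1] -/
def lowV (hk : 1 ≤ k) (z : Site 2) : bslab k :=
  mkV z (lowHeight z) (lowHeight_facts z).2.2 (lowHeight_facts z).1 ((lowHeight_facts z).2.1.trans (by exact_mod_cast hk))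

/-- The shadow of the low vertex over `z` is `z`. [folklore] -/
@[simp] theorem sh_lowV (hk : 1 ≤ k) (z : Site 2) : sh (lowV hk z) = z := sh_mkV _ _ _ _ _

/-- **A vertex of height `≤ 1` is the low vertex of its column.** [folklore] -/
theorem eq_lowV_of_height_le_one (hk : 1 ≤ k) {y : bslab k} (hy : ((y : bccSite) : Site 3) 2 ≤ 1) : y = lowV hk (sh y) := by
  apply eq_of_sh_eq_of_height_eq (by rw [sh_lowV])
  have hpar := even_sh_sum_sub_height y
  obtain ⟨h0, -⟩ := mem_bslab.1 y.2
  obtain ⟨-, -, hpar'⟩ := lowHeight_facts (sh y)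
  obtain ⟨l0, l1, -⟩ := lowHeight_facts (sh y)
  show ((y : bccSite) : Site 3) 2 = lowHeight (sh y)
  obtain ⟨m, hm⟩ := hpar
  obtain ⟨n, hn⟩ := hpar'
  omega

/-- **Low vertices over lattice neighbours are adjacent** (the bond from `lowV z` over `z + σeᵢ` to the other height of `{0,1}`). [cite: ConwaySloane1999, Ch. 4 §7.1] -/
theorem lowV_adj (hk : 1 ≤ k) (z : Site 2) (i : Fin 2) {σ : ℤ} (hσ : σ = 1 ∨ σ = -1) :
    (slabGraph k).Adj (lowV hk z) (lowV hk (z + σ • Pi.single i 1)) := by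
  obtain ⟨l0, l1, -⟩ := lowHeight_facts z
  have hx2 : (((lowV hk z : bslab k) : bccSite) : Site 3) 2 = lowHeight z := rfl
  have hk' : (1 : ℤ) ≤ k := by exact_mod_cast hk
  -- go up from height 0, down from height 1
  by_cases h0 : lowHeight z = 0
  · obtain ⟨y, hy, hy2, hysh⟩ := exists_adj_step (lowV hk z) i hσ (Or.inl rfl) (by rw [hx2]; omega) (by rw [hx2]; omega)
    have : y = lowV hk (z + σ • Pi.single i 1) := by
      rw [eq_lowV_of_height_le_one hk (y := y) (by rw [hy2, hx2]; omega), hysh, sh_lowV]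
    rwa [this] at hy
  · obtain ⟨y, hy, hy2, hysh⟩ := exists_adj_step (lowV hk z) i hσ (Or.inr rfl) (by rw [hx2]; omega) (by rw [hx2]; omega)
    have : y = lowV hk (z + σ • Pi.single i 1) := by
      rw [eq_lowV_of_height_le_one hk (y := y) (by rw [hy2, hx2]; omega), hysh, sh_lowV]
    rwa [this] at hy

/-- **Low vertices over a square are joined inside it** by lattice paths of the low layer (induction on the lattice distance; no radius condition).
[cite: ConwaySloane1999, Ch. 4 §7.1] -/
theorem joined_lowV (hk : 1 ≤ k) {c : Site 2} {u : ℕ} :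
    ∀ (d : ℕ) (z z' : Site 2), (|z' 0 - z 0| + |z' 1 - z 1|).toNat ≤ d → z ∈ sqBall c u → z' ∈ sqBall c u →
      JoinedIn (sqBall c u) (lowV hk z) (lowV hk z') := by
  intro d
  induction d with
  | zero =>
    intro z z' hd hz hz'
    have h0 : z' 0 = z 0 := by
      have := abs_nonneg (z' 0 - z 0); have := abs_nonneg (z' 1 - z 1)
      have : |z' 0 - z 0| = 0 := by omega
      exact sub_eq_zero.1 (abs_eq_zero.1 this)
    have h1 : z' 1 = z 1 := by
      have := abs_nonneg (z' 0 - z 0); have := abs_nonneg (z' 1 - z 1)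
      have : |z' 1 - z 1| = 0 := by omega
      exact sub_eq_zero.1 (abs_eq_zero.1 this)
    have : z' = z := by ext i; fin_cases i; exacts [h0, h1]
    subst this
    exact JoinedIn.refl (by rw [sh_lowV]; exact hz)
  | succ d ih =>
    intro z z' hd hz hz'
    by_cases hle : (|z' 0 - z 0| + |z' 1 - z 1|).toNat ≤ d
    · exact ih z z' hle hz hz'
    · -- pick a coordinate where `z` and `z'` differ and step towards `z'`
      obtain ⟨i, hi⟩ : ∃ i : Fin 2, z' i ≠ z i := by
        by_cases e0 : z' 0 = z 0
        · by_cases e1 : z' 1 = z 1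
          · exfalso; rw [e0, e1, sub_self, sub_self, abs_zero, add_zero] at hle; exact hle (by simp)
          · exact ⟨1, e1⟩
        · exact ⟨0, e0⟩
      obtain ⟨σ, hσ, hσdef⟩ : ∃ σ : ℤ, (σ = 1 ∨ σ = -1) ∧ ((σ = 1 ∧ z i < z' i) ∨ (σ = -1 ∧ z' i < z i)) := by
        rcases lt_or_gt_of_ne hi with h | h
        · exact ⟨-1, Or.inr rfl, Or.inr ⟨rfl, h⟩⟩
        · exact ⟨1, Or.inl rfl, Or.inl ⟨rfl, h⟩⟩
      set z'' : Site 2 := z + σ • Pi.single i 1 with hz''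
      obtain ⟨hzi, hzj⟩ := add_single_apply z σ i
      have hz''S : z'' ∈ sqBall c u := by
        refine mem_sqBall_between hz hz' i ?_ ?_ fun j hj => hzj j hj
        · rw [hz'', hzi]; rcases hσdef with ⟨rfl, h⟩ | ⟨rfl, h⟩ <;> simp only [min_le_iff] <;> omega
        · rw [hz'', hzi]; rcases hσdef with ⟨rfl, h⟩ | ⟨rfl, h⟩ <;> simp only [le_max_iff] <;> omega
      have hstep : JoinedIn (sqBall c u) (lowV hk z) (lowV hk z'') :=
        JoinedIn.of_adj (lowV_adj hk z i hσ) (by rw [sh_lowV]; exact hz) (by rw [sh_lowV]; exact hz''S)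
      refine hstep.trans (ih z'' z' ?_ hz''S hz')
      -- the distance dropped by one
      have hdist : |z' 0 - z'' 0| + |z' 1 - z'' 1| + 1 = |z' 0 - z 0| + |z' 1 - z 1| := by
        fin_cases i
        · have e1 : z'' 1 = z 1 := hzj 1 (by decide)
          change z'' 0 = z 0 + σ at hzi
          rw [e1, hzi]
          rcases hσdef with ⟨rfl, h⟩ | ⟨rfl, h⟩
          · change z 0 < z' 0 at h
            rw [abs_of_pos (by omega : (0:ℤ) < z' 0 - z 0), abs_of_nonneg (by omega : (0:ℤ) ≤ z' 0 - (z 0 + 1))]; ring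
          · change z' 0 < z 0 at h
            rw [abs_of_neg (by omega : z' 0 - z 0 < 0), abs_of_nonpos (by omega : z' 0 - (z 0 + -1) ≤ 0)]; ring
        · have e0 : z'' 0 = z 0 := hzj 0 (by decide)
          change z'' 1 = z 1 + σ at hzi
          rw [e0, hzi]
          rcases hσdef with ⟨rfl, h⟩ | ⟨rfl, h⟩
          · change z 1 < z' 1 at h
            rw [abs_of_pos (by omega : (0:ℤ) < z' 1 - z 1), abs_of_nonneg (by omega : (0:ℤ) ≤ z' 1 - (z 1 + 1))]; ring
          · change z' 1 < z 1 at h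
            rw [abs_of_neg (by omega : z' 1 - z 1 < 0), abs_of_nonpos (by omega : z' 1 - (z 1 + -1) ≤ 0)]; ring
      have hnn : 0 ≤ |z' 0 - z'' 0| + |z' 1 - z'' 1| := by positivity
      omega

/-! ## §4 Connected square lifts; connectedness of the slab -/

/-- **THE LIFT OF EVERY LATTICE SQUARE OF RADIUS `≥ 1` IS CONNECTED INSIDE ITSELF** (`k ≥ 1`) — the structural hypothesis `hconn` of «SqShadowVRoutingX»
for the bcc slab: descend both vertices to the low layer, join there. [cite: ConwaySloane1999, Ch. 4 §7.1] -/
theorem exists_walk_in_lift_sqBall (hk : 1 ≤ k) (c : Site 2) (u : ℕ) (hu : 1 ≤ u) :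
    ∀ a ∈ (sqShadow k).lift (sqBall c u), ∀ b ∈ (sqShadow k).lift (sqBall c u),
      ∃ p : (slabGraph k).Walk a b, ∀ v ∈ p.support, v ∈ (sqShadow k).lift (sqBall c u) := by
  intro a ha b hb
  rw [SqShadow.mem_lift, sqShadow_sh] at ha hb
  obtain ⟨ya, hya1, hyaS, hJa⟩ := exists_joined_low hu _ a (Int.self_le_toNat _) ha
  obtain ⟨yb, hyb1, hybS, hJb⟩ := exists_joined_low hu _ b (Int.self_le_toNat _) hb
  have hlow : JoinedIn (sqBall c u) ya yb := by
    rw [eq_lowV_of_height_le_one hk hya1, eq_lowV_of_height_le_one hk hyb1]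
    exact joined_lowV hk _ _ _ le_rfl hyaS hybS
  exact ((hJa.trans hlow).trans hJb.symm).exists_walk

/-- **The bcc slab `S_k(bcc)` is connected** (`k ≥ 1`). [cite: ConwaySloane1999, Ch. 4 §7.1] -/
theorem connected (hk : 1 ≤ k) : (slabGraph k).Connected := by
  haveI : Nonempty (bslab k) := ⟨origin k⟩
  refine Connected.mk fun a b => ?_
  set u : ℕ := (|sh b 0 - sh a 0| + |sh b 1 - sh a 1|).toNat + 1 with hu
  have ha : a ∈ (sqShadow k).lift (sqBall (sh a) u) := by
    rw [SqShadow.mem_lift, sqShadow_sh, mem_sqBall, sub_self, sub_self, abs_zero]; exact ⟨by positivity, by positivity⟩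
  have hb : b ∈ (sqShadow k).lift (sqBall (sh a) u) := by
    rw [SqShadow.mem_lift, sqShadow_sh, mem_sqBall]
    have h0 := abs_nonneg (sh b 0 - sh a 0); have h1 := abs_nonneg (sh b 1 - sh a 1)
    constructor <;> omega
  obtain ⟨p, -⟩ := exists_walk_in_lift_sqBall hk (sh a) u (by omega) a ha b hb
  exact ⟨p⟩

/-! ## §5 The bcc slabs at their own critical point, p205010-free -/

/-- **`θ_{S_k(bcc)}(v, p_c) = 0` FOR EVERY `k ≥ 1` FROM `ShapedLinkageX R` of the square shadow, any `R ≥ 1`** — Duminil-Copin–Sidoravicius–Tassion's proof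
transplanted to the bcc (001)-slab (square DST layer «SqShadow*» with the thin-instance routing «SqShadowVRoutingX»; the instance supplies connectedness,
Burton–Keane uniqueness, inhabited columns and connected square lifts — all proved; only the finite routing certificate is owed).  Independent of p205010.
[cite: DuminilCopinSidoraviciusTassion2016, Thm. 1 and §2] [cite: BenjaminiSchramm1996, Conj. 4 / Question 3] -/
theorem theta_criticalProb_eq_zero_of_shapedLinkageX (hk : 1 ≤ k) {R : ℕ} (hR : 1 ≤ R) (hL : (sqShadow k).ShapedLinkageX R) (v : bslab k) :
    theta (slabGraph k) v (criticalProbIOf (slabGraph k) v) = 0 :=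
  (sqShadow k).theta_criticalProb_eq_zero_of_shapedLinkageX (connected hk) (numInfiniteClusters_le_one (connected hk))
    (by rw [sqShadow_sh]; exact sh_surjective hk) (exists_walk_in_lift_sqBall hk) hL hR v

/-- **The same from the radius-`3` vertex routing node `LocalLinkage`** (the form «SqShadowVRouting» consumes). Independent of p205010.
[cite: DuminilCopinSidoraviciusTassion2016, Thm. 1 and §2.3] -/
theorem theta_criticalProb_eq_zero_of_localLinkage (hk : 1 ≤ k) (hL : (sqShadow k).LocalLinkage) (v : bslab k) :
    theta (slabGraph k) v (criticalProbIOf (slabGraph k) v) = 0 :=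
  (sqShadow k).theta_criticalProb_eq_zero_of_localLinkage (connected hk) (numInfiniteClusters_le_one (connected hk)) hL v

/-- **The same from shaped linkage at radius `3`.** Independent of p205010. [cite: DuminilCopinSidoraviciusTassion2016, Thm. 1 and §2.3] -/
theorem theta_criticalProb_eq_zero_of_shapedLinkage (hk : 1 ≤ k) (hL : (sqShadow k).ShapedLinkage 3) (v : bslab k) :
    theta (slabGraph k) v (criticalProbIOf (slabGraph k) v) = 0 :=
  (sqShadow k).theta_criticalProb_eq_zero_of_shapedLinkage (connected hk) (numInfiniteClusters_le_one (connected hk)) hL v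

/-- **THE BILAYER UNCONDITIONALLY**: for `k = 1` (one vertex per column) the shadow is injective, the located surgeries are vacuous («SqShadowInjective») and
`θ_{S_1(bcc)}(v, p_c(S_1(bcc))) = 0` at every vertex — p205010-free, RSW-free, certificate-free.  (`S_1(bcc)` is the square lattice drawn along the
diagonals, so this is Harris' theorem again, reached through the transplant: a consistency instance.) [cite: DuminilCopinSidoraviciusTassion2016, Thm. 1 (k = 0)] [cite: Harris1960, Thm.] -/
theorem theta_criticalProb_eq_zero_one (v : bslab 1) : theta (slabGraph 1) v (criticalProbIOf (slabGraph 1) v) = 0 :=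
  (sqShadow 1).theta_criticalProb_eq_zero_of_injective (connected le_rfl) (numInfiniteClusters_le_one (connected le_rfl))
    (by rw [sqShadow_sh]; exact sh_injective le_rfl) v

end BccSlab

end Summit.CriticalPhenomena.PercolationContinuityZ3.Theorems.Transplant

end
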